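/-
Copyright (c) 2026 the pub-hodgecm-mathlib formalisation cell (harness21).  Prover seat hodgecm-mathlib-K2Liu-p09 (g2): Track B «K2-LIT», #184♮ = hLiu418,
payer-internal step (br)-transport half of file #34 `Theorems/K2LiuDoublingZetaGL1.lean` (LEAD F0P6-plan (g10) DEAL K2/STATUS 2026-09-04T02:36:29Z;
DEPMAP v2.5 §10 TABLE A row «docking» (br): the local data live on `U(diag dV)_v` (★ #28s, ★ D7 `LambdaLoc`) but ★ #29s integrates on `U(H)_v`).
-/
import Literature.NumberTheory.K2Lit.LocalDoublingZeta
import Literature.NumberTheory.K2Lit.LocalDoublingUnramifiedHecke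
import HarnessLib

/-!
# Crux `HLiu418`, Track B road `K2_Liu`, file #34 — (br), transport half: LOCAL ZETA DATA ALONG A MEASURABLE GROUP ISOMORPHISM

Cell `hodgecm-mathlib`, crux item hLiu418 = `stmt-HodgeConjecture-24832`, route of record `HCCMUnconditional`; squad K2 ∕ K2Liu, LEAD F0P6-plan (g10),
prover K2Liu-p09 (g2).  THEOREMS ONLY (no `def`, no instance, no notation, no named-fact hypothesis, no `sorry`, default heartbeats); lane
`--supports stmt-HodgeConjecture-24832 --as helper` (count-neutral).  GENERIC: two measurable spaces ∕ groups `G, G'`, a measurable equivalence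
(resp. a group isomorphism measurable both ways) `β : G → G'`, the measure `ν.map β` on `G'`.

In #34 the local doubling data (★ #28s's Banach-representation identity, ★ D7 `LambdaLoc`, the Haar measure with `ν(K_v) = 1`) live on the local
group of `U(diagonal dV)`, while ★ #29s `doublingPartialEuler` integrates over the local groups of `U(H)`; at a good place the docking pin `hιA`
(`ιA = Ad(g)`) is a topological-group isomorphism `β_v` between the two carrying `K_v` to `K_v` and Haar to Haar (★ `localCongr`).  This file is
the bookkeeping of pulling the three ★ `K2Lit` predicates back along such a `β`:
* `localZeta_map_equiv` — `Z_{ν.map β}(Λ', ξ') = Z_ν(Λ' ∘ β, ξ' ∘ β)`;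
* `doublingHeckeOpConverges_map_equiv_iff`, `doublingHeckeOp_map_equiv`, `isDoublingHeckeEigenvector_map_equiv_iff` — the operator
  `∫ Λ' • τ' u d(ν.map β)` and its eigen-identity pull back to `(Λ' ∘ β, τ' ∘ β, ν)`;
* `image_doubleCoset`, `preimage_doubleCoset_map` — `β '' (K t K) = β(K) β(t) β(K)`;
* `isSphericalHeckeEigen_map_iff` — `u` is a `β(K)`-spherical Hecke eigenvector for `(ν.map β, β ∘ t, τ')` iff it is a `K`-spherical one for
  `(ν, t, τ' ∘ β)`, same eigenvalues.

HONEST LABEL: HC_CM is proved only modulo the printed citations (2 remaining named inputs: hLiu418 = stmt-HodgeConjecture-24832,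
h413 = stmt-HodgeConjecture-24833) until rung 0 closes; this file is bookkeeping toward socket s23 and closes no item.
-/

set_option autoImplicit false
set_option linter.dupNamespace false

noncomputable section

open MeasureTheory Set
open Literature.NumberTheory.K2Lit.SiegelDoubled

namespace Summit.HodgeConjecture.HodgeConjecture.Cruxes.HLiu418.K2LiuDoublingZetaGL1Transport

/-! ## §1 Measurable equivalences: `localZeta`, the doubling Hecke operator, eigenvectors -/

section Equiv

variable {G G' : Type} [MeasurableSpace G] [MeasurableSpace G'] (β : G ≃ᵐ G') (ν : Measure G)
variable {V : Type} [NormedAddCommGroup V] [NormedSpace ℂ V]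

/-- `Z_{ν.map β}(Λ', ξ') = Z_ν(Λ' ∘ β, ξ' ∘ β)` (Mathlib `integral_map_equiv`). [cite: Liu2011, §2C p. 863] -/
theorem localZeta_map_equiv (Λ' ξ' : G' → ℂ) :
    localZeta (ν.map β) Λ' ξ' = localZeta ν (fun g => Λ' (β g)) (fun g => ξ' (β g)) := by
  unfold localZeta
  exact integral_map_equiv β _

/-- convergence of the doubling Hecke operator pulls back along `β`. [cite: Li1992, §3 Thm. 3.1] -/
theorem doublingHeckeOpConverges_map_equiv_iff (Λ' : G' → ℂ) (τ' : G' → V →L[ℂ] V) (u : V) :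
    DoublingHeckeOpConverges (ν.map β) Λ' τ' u ↔ DoublingHeckeOpConverges ν (fun g => Λ' (β g)) (fun g => τ' (β g)) u := by
  unfold DoublingHeckeOpConverges
  exact integrable_map_equiv β _

/-- the doubling Hecke operator pulls back along `β`. [cite: Li1992, §3 Thm. 3.1] -/
theorem doublingHeckeOp_map_equiv [CompleteSpace V] (Λ' : G' → ℂ) (τ' : G' → V →L[ℂ] V) (u : V) :
    doublingHeckeOp (ν.map β) Λ' τ' u = doublingHeckeOp ν (fun g => Λ' (β g)) (fun g => τ' (β g)) u := by
  unfold doublingHeckeOp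
  exact integral_map_equiv β _

/-- **doubling Hecke eigenvectors pull back along `β`** (same vector, same eigenvalue). [cite: Li1992, §3 Thm. 3.1] -/
theorem isDoublingHeckeEigenvector_map_equiv_iff [CompleteSpace V] (Λ' : G' → ℂ) (τ' : G' → V →L[ℂ] V) (u : V) (c : ℂ) :
    IsDoublingHeckeEigenvector (ν.map β) Λ' τ' u c ↔
      IsDoublingHeckeEigenvector ν (fun g => Λ' (β g)) (fun g => τ' (β g)) u c := by
  unfold IsDoublingHeckeEigenvector
  rw [doublingHeckeOpConverges_map_equiv_iff, doublingHeckeOp_map_equiv]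

end Equiv

/-! ## §2 Group isomorphisms: double cosets and spherical Hecke eigenvectors -/

section Group

variable {G G' : Type} [Group G] [Group G']

/-- `β '' (K t K') = β(K) β(t) β(K')` for a group isomorphism `β`. [folklore] -/
theorem image_doubleCoset (β : G ≃* G') (t : G) (K K' : Set G) :
    (β : G → G') '' DoubleCoset.doubleCoset t K K' = DoubleCoset.doubleCoset (β t) ((β : G → G') '' K) ((β : G → G') '' K') := by
  simp only [DoubleCoset.doubleCoset, Set.image_mul (β : G ≃* G'), Set.image_singleton]

/-- `β ⁻¹' (β(K) β(t) β(K')) = K t K'` for a group isomorphism `β`. [folklore] -/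
theorem preimage_doubleCoset_image (β : G ≃* G') (t : G) (K K' : Set G) :
    (β : G → G') ⁻¹' DoubleCoset.doubleCoset (β t) ((β : G → G') '' K) ((β : G → G') '' K') = DoubleCoset.doubleCoset t K K' := by
  rw [← image_doubleCoset, Set.preimage_image_eq _ β.injective]

variable [MeasurableSpace G] [MeasurableSpace G'] {V : Type} [NormedAddCommGroup V] [NormedSpace ℂ V]

/-- **spherical Hecke eigenvectors pull back along a bi-measurable group isomorphism `β`**: `u` is a `β(K)`-spherical Hecke eigenvector for
`(ν.map β, β ∘ t, τ')` iff it is a `K`-spherical Hecke eigenvector for `(ν, t, τ' ∘ β)` — same eigenvalues (the double cosets correspond under `β`,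
`image_doubleCoset`; set integrals by Mathlib `MeasurableEmbedding.setIntegral_map`). [cite: Li1992, §3 Thm. 3.1] -/
theorem isSphericalHeckeEigen_map_iff [CompleteSpace V] (β : G ≃* G') (hβ : Measurable β) (hβs : Measurable β.symm) (ν : Measure G)
    (K : Subgroup G) {ι : Type} (t : ι → G) (τ' : G' → V →L[ℂ] V) (u : V) (ev : ι → ℂ) :
    IsSphericalHeckeEigen (ν.map β) (K.map β.toMonoidHom) (fun i => β (t i)) τ' u ev ↔
      IsSphericalHeckeEigen ν K t (fun g => τ' (β g)) u ev := by
  -- `β` as a measurable equivalence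
  have hme : MeasurableEmbedding (β : G → G') :=
    ({ toEquiv := β.toEquiv, measurable_toFun := hβ, measurable_invFun := hβs } : G ≃ᵐ G').measurableEmbedding
  have hK : ((K.map β.toMonoidHom : Subgroup G') : Set G') = (β : G → G') '' (K : Set G) := by
    ext x
    simp only [SetLike.mem_coe, Subgroup.mem_map, MulEquiv.coe_toMonoidHom, Set.mem_image]
  have hset : ∀ i, DoubleCoset.doubleCoset (β (t i)) ((K.map β.toMonoidHom : Subgroup G') : Set G') (K.map β.toMonoidHom : Subgroup G') =
      (β : G → G') '' DoubleCoset.doubleCoset (t i) (K : Set G) K := by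
    intro i
    rw [hK, image_doubleCoset]
  unfold IsSphericalHeckeEigen
  refine and_congr ?_ (forall_congr' fun i => ?_)
  · constructor
    · intro h k hk
      exact h (β k) (Subgroup.mem_map.2 ⟨k, hk, rfl⟩)
    · rintro h k' hk'
      obtain ⟨k, hk, rfl⟩ := Subgroup.mem_map.1 hk'
      exact h k hk
  · rw [hset i, hme.setIntegral_map, Set.preimage_image_eq _ β.injective, IntegrableOn, IntegrableOn, hme.restrict_map,
      hme.integrable_map_iff, Set.preimage_image_eq _ β.injective]
    rfl

end Group

end Summit.HodgeConjecture.HodgeConjecture.Cruxes.HLiu418.K2LiuDoublingZetaGL1Transport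

end
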